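import Summits.QuantumAdvantage.AdviceFreeQNC0.WalkTube
import HarnessLib

/-!
# Cell qa-qnc0 (rung F-Q1, route `RingFrame`, crux α `RingToElim`): THE TUBE BOUND — the `±1`
# walk of a pattern: distance-to-path identity, second moment, REFLECTION PRINCIPLE (P11-B, part 1)

Planner qa-qnc0-p2's ROUND-11 §1 T11-4 / `Sketch11B.lean` plan B1–B3 (towards `TubeMass`,
`WalkTubeMass.lean`).  PROVED:

* B1 `pdist_aPat_eq` — `pdist a (aPat g) = |a| + S_g(a)` with the `±1` walk `S_g(a) = Σ_{i<g} X_i(a)`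
  (`TubeMassProof.S`, `X_i = +1` for the letter `false`); `pdist_conj_aPat` (conjugate = complement),
  `two_wtP_add_S` (`2|a| + S_m = m`), `S_conj`, `nearPath_iff` (cuts `g ≤ m` suffice);
* B2 `sum_S_sq` — `Σ_a S_m(a)² = m·2^m` (mixed moments vanish by the one-letter flip involution
  `flip1`) and `chebyshev_count` — `L²·#{a : L ≤ |S_m(a)|} ≤ m·2^m`;
* B3 `reflection_count` — **the reflection principle in counting form**:
  `#{a : ∃ g ≤ m, S_g(a) ≥ L} ≤ 2·#{a : S_m(a) ≥ L}`.  The reflection `refl L a` flips every letter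
  from the first hitting cut `tau L a` on; it keeps the hitting cut (`tau_refl`), is an involution
  (`refl_refl`), and sends the endpoint to `2S_τ − S_m` (`S_refl_m`), hence maps `{hit, S_m < L}`
  injectively into `{S_m ≥ L}`.

Elementary ([folklore]: André's reflection principle, Feller vol. I ch. III).  WHAT THIS IS NOT: no
statement about the game; separation NOT moved.
-/

noncomputable section

open Classical

namespace Summit.QuantumAdvantage.AdviceFreeQNC0

open Finset
open Literature.Computability.MetaComplexity Literature.Computability.MetaComplexity.Smolensky
open F4

namespace TubeMassProof

variable {m : ℕ}

/-! ### The `±1` walk of a pattern -/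

/-- the step `X_i(a) = +1` for the letter `false` (`1`), `−1` for `true` (`2`). -/
def step (a : Fin m → Bool) (i : Fin m) : ℤ := if a i = true then -1 else 1

/-- the partial sum `S_g(a) = Σ_{i<g} X_i(a)`. -/
def S (a : Fin m → Bool) (g : ℕ) : ℤ := ∑ i : Fin m, if i.val < g then step a i else 0

/-- the weight `|a| = #{i : a i = true}`. -/
def wtP (a : Fin m → Bool) : ℕ := (univ.filter fun i : Fin m => a i = true).card

/-- Partial sums depend only on the prefix. -/
theorem S_congr {a b : Fin m → Bool} {g : ℕ} (h : ∀ i : Fin m, i.val < g → a i = b i) :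
    S a g = S b g := by
  unfold S
  refine Finset.sum_congr rfl fun i _ => ?_
  by_cases hi : i.val < g
  · rw [if_pos hi, if_pos hi]; unfold step; rw [h i hi]
  · rw [if_neg hi, if_neg hi]

/-- Beyond the last letter the walk is constant: `S_g = S_m` for `g ≥ m`. -/
theorem S_of_le {a : Fin m → Bool} {g : ℕ} (hg : m ≤ g) : S a g = S a m := by
  unfold S
  refine Finset.sum_congr rfl fun i _ => ?_
  rw [if_pos (lt_of_lt_of_le i.isLt hg), if_pos i.isLt]

/-- Conjugation negates the walk. -/
theorem S_conj (a : Fin m → Bool) (g : ℕ) : S (conj a) g = - S a g := by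
  unfold S
  rw [← Finset.sum_neg_distrib]
  refine Finset.sum_congr rfl fun i _ => ?_
  by_cases hi : i.val < g
  · rw [if_pos hi, if_pos hi]
    unfold step conj
    cases a i <;> simp
  · rw [if_neg hi, if_neg hi, neg_zero]

/-- `2|a| + S_m(a) = m`. -/
theorem two_wtP_add_S (a : Fin m → Bool) : 2 * (wtP a : ℤ) + S a m = m := by
  unfold wtP S
  rw [Finset.card_filter, Nat.cast_sum, Finset.mul_sum, ← Finset.sum_add_distrib]
  have e : ∀ i : Fin m, (2 * ((if a i = true then 1 else 0 : ℕ) : ℤ) +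
      (if i.val < m then step a i else 0)) = 1 := by
    intro i
    rw [if_pos i.isLt]
    unfold step
    cases a i <;> simp
  rw [Finset.sum_congr rfl fun i _ => e i, Finset.sum_const, card_univ, Fintype.card_fin]
  simp

/-! ### B1: the walk identity for the distance to the path -/

/-- **B1**: `pdist a (aPat g) = |a| + S_g(a)`. -/
theorem pdist_aPat_eq (a : Fin m → Bool) (g : ℕ) :
    (pdist a (aPat g) : ℤ) = (wtP a : ℤ) + S a g := by
  unfold pdist wtP S
  rw [Finset.card_filter, Finset.card_filter, Nat.cast_sum, Nat.cast_sum, ← Finset.sum_add_distrib]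
  refine Finset.sum_congr rfl fun i _ => ?_
  unfold aPat step
  by_cases hi : i.val < g
  · rw [if_pos hi]
    cases a i <;> simp [hi]
  · rw [if_neg hi]
    cases a i <;> simp [hi]

/-- The conjugate's distance to the path is the complement. -/
theorem pdist_conj_aPat (a : Fin m → Bool) (g : ℕ) :
    pdist (conj a) (aPat g) + pdist a (aPat g) = m := by
  unfold pdist
  have e : (univ.filter fun i : Fin m => conj a i ≠ aPat g i) =
      univ.filter fun i : Fin m => ¬ (a i ≠ aPat g i) := by
    refine filter_congr fun i _ => ?_
    unfold conj
    cases a i <;> cases aPat g i <;> simp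
  rw [e, add_comm, card_filter_add_card_filter_not, card_univ, Fintype.card_fin]

/-- Path patterns stabilise: `aPat g = aPat m` on `m` letters for `g ≥ m`. -/
theorem aPat_of_le {g : ℕ} (hg : m ≤ g) : (aPat g : Fin m → Bool) = aPat m := by
  funext i
  unfold aPat
  rw [decide_eq_true (lt_of_lt_of_le i.isLt hg), decide_eq_true i.isLt]

/-- `NearPath` may be tested at cuts `g ≤ m` only. -/
theorem nearPath_iff (k : ℕ) (a : Fin m → Bool) :
    NearPath k a ↔ ∃ g, g ≤ m ∧ pdist a (aPat g) ≤ k := by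
  constructor
  · rintro ⟨g, hg⟩
    rcases le_or_gt g m with h | h
    · exact ⟨g, h, hg⟩
    · exact ⟨m, le_rfl, by rwa [aPat_of_le h.le] at hg⟩
  · rintro ⟨g, -, hg⟩
    exact ⟨g, hg⟩

/-! ### B2: the second moment `Σ_a S_m(a)² = m·2^m` and Chebyshev -/

/-- flipping one letter. -/
def flip1 (i : Fin m) (a : Fin m → Bool) : Fin m → Bool := Function.update a i (!a i)

/-- `flip1 i` is an involution. -/
theorem flip1_flip1 (i : Fin m) (a : Fin m → Bool) : flip1 i (flip1 i a) = a := by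
  funext j
  unfold flip1
  by_cases h : j = i
  · subst h; simp
  · simp [Function.update_of_ne h]

/-- Flipping letter `i` negates `X_i` and keeps `X_j`, `j ≠ i`. -/
theorem step_flip1_self (i : Fin m) (a : Fin m → Bool) : step (flip1 i a) i = - step a i := by
  unfold step flip1
  rw [Function.update_self]
  cases a i <;> simp

/-- see `step_flip1_self`. -/
theorem step_flip1_ne {i j : Fin m} (h : j ≠ i) (a : Fin m → Bool) :
    step (flip1 i a) j = step a j := by
  unfold step flip1
  rw [Function.update_of_ne h]

/-- Mixed second moments vanish: `Σ_a X_i(a) X_j(a) = 0` for `i ≠ j`. -/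
theorem sum_step_mul_step_eq_zero {i j : Fin m} (h : i ≠ j) :
    ∑ a : Fin m → Bool, step a i * step a j = 0 := by
  have h1 : ∑ a : Fin m → Bool, step (flip1 i a) i * step (flip1 i a) j =
      ∑ a : Fin m → Bool, step a i * step a j :=
    Fintype.sum_equiv (Function.Involutive.toPerm _ (flip1_flip1 i)) _ _ (fun a => rfl)
  have h2 : ∑ a : Fin m → Bool, step (flip1 i a) i * step (flip1 i a) j =
      - ∑ a : Fin m → Bool, step a i * step a j := by
    rw [← Finset.sum_neg_distrib]
    refine Finset.sum_congr rfl fun a _ => ?_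
    rw [step_flip1_self, step_flip1_ne h.symm]; ring
  linarith

/-- `X_i² = 1`. -/
theorem step_sq (a : Fin m → Bool) (i : Fin m) : step a i * step a i = 1 := by
  unfold step; cases a i <;> simp

/-- **B2 (second moment)**: `Σ_a S_m(a)² = m·2^m`. -/
theorem sum_S_sq : ∑ a : Fin m → Bool, S a m ^ 2 = (m : ℤ) * 2 ^ m := by
  have e : ∀ a : Fin m → Bool, S a m = ∑ i : Fin m, step a i := by
    intro a
    unfold S
    exact Finset.sum_congr rfl fun i _ => if_pos i.isLt
  simp_rw [e, sq, Finset.sum_mul_sum]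
  rw [Finset.sum_comm]
  have inner : ∀ i : Fin m, ∑ a : Fin m → Bool, ∑ j : Fin m, step a i * step a j = 2 ^ m := by
    intro i
    rw [Finset.sum_comm]
    rw [Finset.sum_eq_single i]
    · simp_rw [step_sq]
      rw [Finset.sum_const, card_univ, Fintype.card_fun, Fintype.card_bool, Fintype.card_fin]
      simp
    · intro j _ hj
      exact sum_step_mul_step_eq_zero (Ne.symm hj)
    · intro h; exact absurd (mem_univ i) h
  rw [Finset.sum_congr rfl fun i _ => inner i, Finset.sum_const, card_univ, Fintype.card_fin]
  simp

/-- **B2 (Chebyshev, counting form)**: `L² · #{a : L ≤ |S_m(a)|} ≤ m · 2^m`. -/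
theorem chebyshev_count (L : ℕ) :
    (L : ℤ) ^ 2 * (univ.filter fun a : Fin m → Bool => (L : ℤ) ≤ |S a m|).card ≤ (m : ℤ) * 2 ^ m := by
  rw [← sum_S_sq]
  calc (L : ℤ) ^ 2 * ((univ.filter fun a : Fin m → Bool => (L : ℤ) ≤ |S a m|).card : ℤ)
      = ∑ a ∈ univ.filter (fun a : Fin m → Bool => (L : ℤ) ≤ |S a m|), (L : ℤ) ^ 2 := by
        rw [Finset.sum_const, nsmul_eq_mul, mul_comm]
    _ ≤ ∑ a ∈ univ.filter (fun a : Fin m → Bool => (L : ℤ) ≤ |S a m|), S a m ^ 2 := by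
        refine Finset.sum_le_sum fun a ha => ?_
        have h := (mem_filter.1 ha).2
        have hL : (0 : ℤ) ≤ L := by positivity
        calc (L : ℤ) ^ 2 ≤ |S a m| ^ 2 := pow_le_pow_left₀ hL h 2
          _ = S a m ^ 2 := sq_abs _
    _ ≤ ∑ a : Fin m → Bool, S a m ^ 2 :=
        Finset.sum_le_sum_of_subset_of_nonneg (filter_subset _ _) fun a _ _ => sq_nonneg _

/-! ### B3: the reflection principle -/

/-- the walk reaches level `L` at some cut `g ≤ m`. -/
def Hits (L : ℤ) (a : Fin m → Bool) : Prop := ∃ g : ℕ, g ≤ m ∧ L ≤ S a g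

/-- the first hitting cut (junk `0` if never). -/
def tau (L : ℤ) (a : Fin m → Bool) : ℕ :=
  if h : Hits L a then Nat.find h else 0

/-- REFLECTION: flip every letter from the first hitting cut on. -/
def refl (L : ℤ) (a : Fin m → Bool) : Fin m → Bool :=
  fun i => if i.val < tau L a then a i else !a i

/-- The first hitting cut hits, and is at most `m`. -/
theorem tau_spec {L : ℤ} {a : Fin m → Bool} (h : Hits L a) : tau L a ≤ m ∧ L ≤ S a (tau L a) := by
  unfold tau
  rw [dif_pos h]
  exact Nat.find_spec h

/-- Before the first hitting cut the walk is below `L`. -/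
theorem lt_of_lt_tau {L : ℤ} {a : Fin m → Bool} (h : Hits L a) {g : ℕ} (hg : g < tau L a) :
    S a g < L := by
  unfold tau at hg
  rw [dif_pos h] at hg
  have := Nat.find_min h hg
  have hgm : g ≤ m := le_trans hg.le ((by unfold tau; rw [dif_pos h] : tau L a = Nat.find h) ▸
    (tau_spec h).1)
  by_contra hc
  exact this ⟨hgm, not_lt.1 hc⟩

/-- The reflection keeps the prefix, hence the partial sums up to the hitting cut. -/
theorem S_refl_of_le {L : ℤ} {a : Fin m → Bool} {g : ℕ} (hg : g ≤ tau L a) :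
    S (refl L a) g = S a g :=
  S_congr fun i hi => by unfold refl; rw [if_pos (lt_of_lt_of_le hi hg)]

/-- The reflection has the same first hitting cut. -/
theorem tau_refl {L : ℤ} {a : Fin m → Bool} (h : Hits L a) : tau L (refl L a) = tau L a := by
  have hτ := tau_spec h
  have h' : Hits L (refl L a) := ⟨tau L a, hτ.1, by rw [S_refl_of_le le_rfl]; exact hτ.2⟩
  unfold tau
  rw [dif_pos h', dif_pos h]
  rw [Nat.find_eq_iff]
  have e : Nat.find h = tau L a := by unfold tau; rw [dif_pos h]
  refine ⟨⟨by rw [e]; exact hτ.1, by rw [e, S_refl_of_le le_rfl]; exact hτ.2⟩, fun k hk => ?_⟩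
  rintro ⟨-, hk2⟩
  rw [e] at hk
  rw [S_refl_of_le hk.le] at hk2
  exact absurd hk2 (not_le.2 (lt_of_lt_tau h hk))

/-- The reflection is an involution on the hitting set. -/
theorem refl_refl {L : ℤ} {a : Fin m → Bool} (h : Hits L a) : refl L (refl L a) = a := by
  funext i
  rw [show refl L (refl L a) i = (if i.val < tau L (refl L a) then refl L a i else !(refl L a i))
    from rfl, tau_refl h]
  by_cases hi : i.val < tau L a
  · rw [if_pos hi]; unfold refl; rw [if_pos hi]
  · rw [if_neg hi]; unfold refl; rw [if_neg hi, Bool.not_not]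

/-- The reflected endpoint: `S_m(refl a) = 2·S_τ(a) − S_m(a)`. -/
theorem S_refl_m {L : ℤ} {a : Fin m → Bool} (h : Hits L a) :
    S (refl L a) m = 2 * S a (tau L a) - S a m := by
  have hτ := (tau_spec h).1
  have split : ∀ b : Fin m → Bool, S b m = S b (tau L a) +
      ∑ i : Fin m, if tau L a ≤ i.val then step b i else 0 := by
    intro b
    unfold S
    rw [← Finset.sum_add_distrib]
    refine Finset.sum_congr rfl fun i _ => ?_
    rw [if_pos i.isLt]
    by_cases hi : i.val < tau L a
    · rw [if_pos hi, if_neg (not_le.2 hi), add_zero]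
    · rw [if_neg hi, if_pos (not_lt.1 hi), zero_add]
  have hneg : ∑ i : Fin m, (if tau L a ≤ i.val then step (refl L a) i else 0) =
      - ∑ i : Fin m, (if tau L a ≤ i.val then step a i else 0) := by
    rw [← Finset.sum_neg_distrib]
    refine Finset.sum_congr rfl fun i _ => ?_
    by_cases hi : tau L a ≤ i.val
    · rw [if_pos hi, if_pos hi]
      unfold step refl
      rw [if_neg (not_lt.2 hi)]
      cases a i <;> simp
    · rw [if_neg hi, if_neg hi, neg_zero]
  rw [split (refl L a), S_refl_of_le le_rfl, hneg]
  have := split a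
  linarith

/-- **B3 (reflection principle, counting form)**: `#{∃ g ≤ m, S_g ≥ L} ≤ 2·#{S_m ≥ L}`. -/
theorem reflection_count (L : ℤ) :
    (univ.filter fun a : Fin m → Bool => Hits L a).card ≤
      2 * (univ.filter fun a : Fin m → Bool => L ≤ S a m).card := by
  set A := univ.filter fun a : Fin m → Bool => Hits L a with hA
  set T := univ.filter fun a : Fin m → Bool => L ≤ S a m with hT
  have hsplit := (card_filter_add_card_filter_not (s := A) (fun a => L ≤ S a m)).symm
  have h1 : (A.filter fun a => L ≤ S a m).card ≤ T.card :=
    card_le_card fun a ha => by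
      rw [mem_filter] at ha; rw [hT, mem_filter]; exact ⟨mem_univ _, ha.2⟩
  have h2 : (A.filter fun a => ¬ L ≤ S a m).card ≤ T.card := by
    refine card_le_card_of_injOn (fun a => refl L a) (fun a ha => ?_) (fun a ha b hb hab => ?_)
    · rw [mem_coe, mem_filter, hA, mem_filter] at ha
      have hh : Hits L a := ha.1.2
      rw [mem_coe, hT, mem_filter]
      refine ⟨mem_univ _, ?_⟩
      rw [S_refl_m hh]
      have := (tau_spec hh).2
      push Not at ha
      linarith [ha.2]
    · rw [mem_coe, mem_filter, hA, mem_filter] at ha hb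
      have := congrArg (refl L) hab
      rwa [refl_refl ha.1.2, refl_refl hb.1.2] at this
  omega

end TubeMassProof

end Summit.QuantumAdvantage.AdviceFreeQNC0

end
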